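import Summits.Langlands.Langlands.Theses.RegularSerreAbelianSurfaces

/-!
# `RegularSerreAbelianSurfaces.SectorComplement` (stmt-Langlands-17571) — logical position (SUSPECT-EQUIVALENCE audit)

Crux-strategist unit `cstrat-stmt-Langlands-17571-q1` (2026-08-17). The payload witness
`Theorems.skinnerWilesDefectOne_sectorComplement_iff_of_target` (Theorems/SkinnerWilesDefectOneSectorComplement.lean:51)
concerns the HOMONYMOUS frame item of route SkinnerWilesDefectOne (`ReducibleOrdinaryModular → Langlands`,
stmt-Langlands-12923), and the route flag `restated` cites
`Theorems.SectorComplement.Negative.sectorComplement_iff_langlands` (Theorems/SectorComplement/Negative/RepeatedRootSocleVacuity.lean),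
which concerns the homonymous frame item of route RepeatedRootSocle (stmt-Langlands-18089; unconditional THERE because that
route's sector statement was vacuous). Neither is a statement about THIS route's decl. This file records the position of
THIS route's frame `SectorComplement : Prop := (AbelianSurfacesModular-text, inlined verbatim) → _root_.Langlands`,
kernel-checked, so the audit (EQUIVALENCE-AUDIT_RegularSerreAbelianSurfaces.md) rests on theorems and not on the homonyms:

* `rsas_sectorComplement_iff`            : `SectorComplement ↔ (AbelianSurfacesModular → Langlands)` (`Iff.rfl`: the inlined
  antecedent IS the target decl);
* `rsas_sectorComplement_of_langlands`   : `Langlands → SectorComplement` (the frame is implied by the summit);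
* `rsas_serreToAbelianSurfaces_iff`      : `SerreToAbelianSurfaces ↔ (OrdinarySerreGSp4 → AbelianSurfacesModular)` (`Iff.rfl`);
* `rsas_target_of_cruxes`                 : `OrdinarySerreGSp4 → SerreToAbelianSurfaces → AbelianSurfacesModular` (modus ponens —
  the body of `closes` minus its last step);
* `rsas_sectorComplement_iff_of_target`  : under `AbelianSurfacesModular`, `SectorComplement ↔ Langlands` — the suspect
  equivalence, verbatim for THIS route;
* `rsas_sectorComplement_iff_of_cruxes`  : under the two ranked cruxes `OrdinarySerreGSp4`, `SerreToAbelianSurfaces` (the other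
  binders of `closes`), `SectorComplement ↔ Langlands` (`→` is the route's sorry-free `closes`);
* `rsas_not_sectorComplement_iff`        : `¬ SectorComplement ↔ AbelianSurfacesModular ∧ ¬ Langlands` (a refutation of the
  frame = a proof of the open target AND a disproof of the audited summit);
* `rsas_sectorComplement_iff_not_or`     : truth table `SectorComplement ↔ ¬ AbelianSurfacesModular ∨ Langlands`;
* `rsas_serreToAbelianSurfaces_of_target`, `rsas_serreToAbelianSurfaces_iff_target_of_serre` : the bridge crux is implied by the
  target and, given the Serre crux, IS the target (so the pair C1/S1 is an exact two-cell cut of the target, not a padded one);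
* `rsas_assembly_iff`, `rsas_assembly_of_sectorComplement`, `rsas_assembly_iff_sectorComplement_of_cruxes` : the `Assembly`
  item (`OrdinarySerreGSp4 → SerreToAbelianSurfaces → Langlands`) is implied by the frame and, given the two cruxes, equivalent
  to it (and to the summit).

`Langlands → AbelianSurfacesModular` (target implied by the summit) is deliberately ABSENT: true in substance (direction (B),
`n = 4`, `F = ℚ`, applied to the framed `H¹_ét(A_ℚ̄, ℚ̄_ℓ)`), but not formal in this cone — it needs two named facts the tree
lacks (a.e. unramifiedness of `V_ℓ A`, Néron–Ogg–Shafarevich / Serre–Tate; de Rham at `ℓ` for Fontaine's pinned datum,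
Faltings / Tsuji) to discharge `IsGeometricFramed 𝓡 r` (refuter rattack-17571, 05:13Z). Consequently the UNCONDITIONAL
`SectorComplement ↔ Langlands` of the RepeatedRootSocle homonym has no analogue here unless `AbelianSurfacesModular` were
provable — it is an open problem (modularity of all abelian surfaces over `ℚ`; BCGP 2025 Thm 1.1 covers a positive
proportion only), not a vacuous statement (`AbelianVariety ℚ` is scheme-theoretic, the conclusion `∃ π : CuspidalAutomorphicRepData
4 ℚ hcpt, …` has no junk inhabitant).

Nothing of the route is asserted: every conclusion below is an `↔`, an implication between items, or a negation. [folklore]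
-/

set_option linter.dupNamespace false

namespace Summit.Langlands.Langlands.Cruxes.SectorComplement.EquivalenceAuditRSAS

open Summit.Langlands.Langlands.Theses.RegularSerreAbelianSurfaces

/-- The frame is literally `AbelianSurfacesModular → Langlands` (the item inlines the target text verbatim). [folklore] -/
theorem rsas_sectorComplement_iff : SectorComplement ↔ (AbelianSurfacesModular → _root_.Langlands) :=
  Iff.rfl

/-- The frame is implied by the summit (discard the sector hypothesis): probe `S → C` succeeds, as for every frame.
[folklore] -/
theorem rsas_sectorComplement_of_langlands : _root_.Langlands → SectorComplement :=
  fun h _ ↦ h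

/-- The bridge crux is literally `OrdinarySerreGSp4 → AbelianSurfacesModular`. [folklore] -/
theorem rsas_serreToAbelianSurfaces_iff : SerreToAbelianSurfaces ↔ (OrdinarySerreGSp4 → AbelianSurfacesModular) :=
  Iff.rfl

/-- The two ranked cruxes give the target by modus ponens (the body of `closes` short of its last step). [folklore] -/
theorem rsas_target_of_cruxes (h₁ : OrdinarySerreGSp4) (h₂ : SerreToAbelianSurfaces) : AbelianSurfacesModular :=
  h₂ h₁

/-- Under the route target the frame IS the summit: the suspect equivalence, verbatim for THIS route (cf. the homonymous
`skinnerWilesDefectOne_sectorComplement_iff_of_target`). [folklore] -/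
theorem rsas_sectorComplement_iff_of_target (hX : AbelianSurfacesModular) : SectorComplement ↔ _root_.Langlands :=
  ⟨fun hC ↦ hC hX, fun h _ ↦ h⟩

/-- Under the other two binders of the deciding theorem — the Serre crux `OrdinarySerreGSp4` and the bridge
`SerreToAbelianSurfaces` — the frame is equivalent to the summit (`→` is the route's sorry-free `closes`). So this item can
close only together with the summit once the route's two ranked cruxes land. [folklore] -/
theorem rsas_sectorComplement_iff_of_cruxes (h₁ : OrdinarySerreGSp4) (h₂ : SerreToAbelianSurfaces) :
    SectorComplement ↔ _root_.Langlands :=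
  ⟨fun hC ↦ closes h₁ h₂ hC, fun h _ ↦ h⟩

/-- The same equivalence through the target, independent of `closes`. [folklore] -/
theorem rsas_sectorComplement_iff_of_cruxes' (h₁ : OrdinarySerreGSp4) (h₂ : SerreToAbelianSurfaces) :
    SectorComplement ↔ _root_.Langlands :=
  rsas_sectorComplement_iff_of_target (rsas_target_of_cruxes h₁ h₂)

/-- The exact content of a refutation of the frame: `¬ SectorComplement ↔ AbelianSurfacesModular ∧ ¬ Langlands` — prove the
open target (every abelian surface over `ℚ` with irreducible `H¹` is `GL₄`-modular) AND disprove the audited summit.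
[folklore] -/
theorem rsas_not_sectorComplement_iff : ¬ SectorComplement ↔ AbelianSurfacesModular ∧ ¬ _root_.Langlands :=
  Classical.not_imp

/-- Any refutation of the frame is a disproof of the formal summit. [folklore] -/
theorem rsas_not_langlands_of_not_sectorComplement : ¬ SectorComplement → ¬ _root_.Langlands :=
  fun h ↦ (rsas_not_sectorComplement_iff.1 h).2

/-- Truth table of the frame: `SectorComplement ↔ ¬ AbelianSurfacesModular ∨ Langlands`. PROVABLE only by proving the
summit or refuting the target (a non-modular abelian surface over `ℚ`); REFUTABLE only in the world "target true, summit
false". [folklore] -/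
theorem rsas_sectorComplement_iff_not_or : SectorComplement ↔ ¬ AbelianSurfacesModular ∨ _root_.Langlands :=
  imp_iff_not_or

/-- The bridge crux is implied by the target (discard the Serre hypothesis). [folklore] -/
theorem rsas_serreToAbelianSurfaces_of_target : AbelianSurfacesModular → SerreToAbelianSurfaces :=
  fun h _ ↦ h

/-- Given the Serre crux, the bridge IS the target: the pair (Serre crux, bridge) is an exact two-cell cut of the target
along BCGP 2025 Lemma 10.4.1, hypothesis / implication. [folklore] -/
theorem rsas_serreToAbelianSurfaces_iff_target_of_serre (h₁ : OrdinarySerreGSp4) :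
    SerreToAbelianSurfaces ↔ AbelianSurfacesModular :=
  ⟨fun h₂ ↦ h₂ h₁, fun h _ ↦ h⟩

/-- Truth table of the bridge: `SerreToAbelianSurfaces ↔ ¬ OrdinarySerreGSp4 ∨ AbelianSurfacesModular` — it would hold EX
FALSO only if the Serre crux were refutable as typed (then the route is dead at its rank-2 crux, not hollow). [folklore] -/
theorem rsas_serreToAbelianSurfaces_iff_not_or :
    SerreToAbelianSurfaces ↔ ¬ OrdinarySerreGSp4 ∨ AbelianSurfacesModular :=
  imp_iff_not_or

/-- The `Assembly` item is literally the chain without the junction. [folklore] -/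
theorem rsas_assembly_iff : Assembly ↔ (OrdinarySerreGSp4 → SerreToAbelianSurfaces → _root_.Langlands) :=
  Iff.rfl

/-- The frame implies the `Assembly` item (it is `closes` with the frame curried in). [folklore] -/
theorem rsas_assembly_of_sectorComplement : SectorComplement → Assembly :=
  fun hC h₁ h₂ ↦ hC (h₂ h₁)

/-- The summit implies the `Assembly` item. [folklore] -/
theorem rsas_assembly_of_langlands : _root_.Langlands → Assembly :=
  fun h _ _ ↦ h

/-- Given the two ranked cruxes, `Assembly`, the frame and the summit are all equivalent. [folklore] -/
theorem rsas_assembly_iff_sectorComplement_of_cruxes (h₁ : OrdinarySerreGSp4) (h₂ : SerreToAbelianSurfaces) :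
    Assembly ↔ SectorComplement :=
  ⟨fun hA _ ↦ hA h₁ h₂, rsas_assembly_of_sectorComplement⟩

/-- … and `Assembly ↔ Langlands` under the same two cruxes. [folklore] -/
theorem rsas_assembly_iff_langlands_of_cruxes (h₁ : OrdinarySerreGSp4) (h₂ : SerreToAbelianSurfaces) :
    Assembly ↔ _root_.Langlands :=
  ⟨fun hA ↦ hA h₁ h₂, rsas_assembly_of_langlands⟩

/-- Bookkeeping identity available WITHOUT `Langlands → AbelianSurfacesModular`: the summit is equivalent to
"target-implies-summit together with (target → summit) → summit", i.e. `Langlands ↔ (SectorComplement ∧ (SectorComplement →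
Langlands))` — recorded only to make explicit that the frame carries no content beyond the summit's. [folklore] -/
theorem rsas_langlands_iff_frame_and_discharge :
    _root_.Langlands ↔ (SectorComplement ∧ (SectorComplement → _root_.Langlands)) :=
  ⟨fun h ↦ ⟨rsas_sectorComplement_of_langlands h, fun _ ↦ h⟩, fun h ↦ h.2 h.1⟩

end Summit.Langlands.Langlands.Cruxes.SectorComplement.EquivalenceAuditRSAS
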